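import Summits.BirchSwinnertonDyer.Rank1Residual.GaloisImage.DivisionCertificateCheckers
import HarnessLib

/-!
# KERNEL DECIDER for local `n`-divisibility `P ∈ n·E(ℚ_p)` of a rational point of an integer
# model at any prime `p`, from the `n`-division equation and a `decide`-checked certificate;
# specialised to `n = 3` (team n1011, row T-DIV3L, FILE D3 — lead R5-82 (k) / R5-83 (d) "road (b)";
# the checkers and the two `p`-adic lemmas are FILE D2 `DivisionCertificateCheckers`)

HONEST FRAMING (cell `b2b-bsdres`, run/shared/lean/b2b/bsd-rank1-residual/, verbatim in every
file): the goal of the cell is to DELETE the COMBINATION-SHAPED residual classes of the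
Birch–Swinnerton-Dyer formula for ALL analytic-rank `≤ 1` elliptic curves over `ℚ` — "full BSD
formula for every rank `≤ 1` curve in class `C`" assembled STRICTLY from published theorems — so
that the rank-`≤ 1` remainder becomes exactly the CONSTRUCTION-SHAPED classes, which are TYPED
(missing-input `Prop`s), NOT attempted. This is not "finishing BSD". Team n1011 (N10/N11): research
route; this file is a TOOL; nothing is booked by it; no mark / label moved; X4 stays
CONSTRUCTION-SHAPED. THEOREMS + small computable certificate-checker definitions (`Bool`-valued,
no mathematical content); no named fact, no `sorry`.

## What

For an integer model `W = ⟨a₁, …, a₆⟩` over `ℚ`, a rational affine point `P = (x, y)` and a prime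
`p`, the question "`∃ Q ∈ E(ℚ_p), n • Q = P|_{ℚ_p}`?" is decided by the `n`-division equation
`F_P = den(x)·Φₙ − num(x)·ΨSqₙ ∈ ℤ[X]` (FILE D1; for `n = 3` the computable list `threeDivList`):

* **YES** (`exists_nsmul_eq_padic_of_divCertOKAt`, `n = 3`: `exists_three_nsmul_eq_padic_of_cert`):
  a certificate `(c, m, N, w)` checked by integer arithmetic — Hensel data `p^m ∥ F_P′(c)`,
  `p^N ∣ F_P(c)`, `2m + 1 ≤ N` (⟹ a root `z ∈ ℤ_p`, `‖z − c‖ ≤ p^{-(N−m)}`, Mathlib `hensels_lemma`)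
  and the `g`-square datum `p^w ∥ g(c)`, `w + δ_p + m ≤ N`, square flag (T-LOC3L FILE L3
  `gEntryOKAt` / `sqFlagAt`, FILE L1 `isSquare_iff_of_norm_sub_le`; ⟹ `g(z) = 4z³ + b₂z² + 2b₄z + b₆`
  is a non-zero square, so the fibre over `z` is non-empty, T-LOC3T FILE B `equation_iff_sq_eq_g`)
  ⟹ `P|_{ℚ_p} = n • Q` with `Q = ±(z, y_z)` (FILE D1 `exists_nsmul_eq_of_eval_divEq_eq_zero`).
  This is LITERALLY the first disjunct of `hdiv` in
  `VisibleWitness.exists_sha_ne_zero_of_congr_of_locallyDivisible` over `ℚ_[p]` (the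
  `v.adicCompletion ℚ` currency follows through n1011-p09's transport
  `LocalDivisibility.exists_nsmul_eq_baseChange_adicCompletion_of_padic`, FILE D4
  `LocalThreeDivisibilityAdicCompletionAt`).
* **NO** (`not_exists_nsmul_eq_padic_of_nonDivCheckAt`, `n = 3`:
  `not_exists_three_nsmul_eq_padic_of_check`): the leading coefficient of `F_P` is a `p`-unit
  (`den(x)` for `n = 3`: `P ∉ E₁(ℚ_p)`) — then every root of `F_P` in `ℚ_p` lies in `ℤ_p`
  (`norm_le_one_of_aeval_eq_zero`, ultrametric) — and the EMPTY root census
  `RootCensus.check₂ p F_P k []` (T-LOC3T FILE A/A1b/A2) ⟹ no `Q`. GLOBAL COROLLARY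
  (`not_mem_range_zsmul_of_nonDivCheckAt`, `n = 3`: `not_mem_range_zsmul_three_of_check`):
  **`P ∉ n·E(ℚ)`** in the exact currency `P ∉ (zsmulAddGroupHom (n : ℤ)).range` of the binder `hP`
  of the witness theorem — one auxiliary prime `p` per point.

Certificates are FOUND outside the kernel (`census/div3_cert.py` in the seat folder /
`HOME/b2b-bsdres-n1011-p17/gen9/`) and CHECKED inside by `decide +kernel`.

References: [SilvermanAEC2009] Ex. 3.7 (d), VII.3; [Serre1973] Ch. II §3.3 (square classes);
Hensel's lemma (Mathlib `hensels_lemma`).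
-/

set_option autoImplicit false

noncomputable section

open scoped Classical
open Polynomial WeierstrassCurve
open Summit.BirchSwinnertonDyer.Rank1Residual.GaloisImage.RootCensus
open Summit.BirchSwinnertonDyer.Rank1Residual.GaloisImage.PadicSquareClass
open Summit.BirchSwinnertonDyer.Rank1Residual.GaloisImage.LocalTorsion3 (bInvs gList equation_iff_sq_eq_g)
open Summit.BirchSwinnertonDyer.Rank1Residual.GaloisImage.LocalTorsion3At
  (sqPrecAt sqFlagAt gEntryOKAt one_le_sqPrecAt sqPrecAt_eq_three_of_eq_two
    isSquare_intCast_padic_iff_sqFlagAt)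
open Summit.BirchSwinnertonDyer.Rank1Residual.GaloisImage.ThreeDivision

namespace Summit.BirchSwinnertonDyer.Rank1Residual.GaloisImage.DivisionDecider

/-! ### §1 Soundness for a general `n` (the division equation `l` given abstractly) -/

section Main

variable (p : ℕ) [hp : Fact p.Prime] (a₁ a₂ a₃ a₄ a₆ : ℤ)

/-- The base change to `ℚ_p` of the integer model has the cast coefficients. -/
private theorem baseChange_eq (W : WeierstrassCurve ℚ) (hW : W = ⟨a₁, a₂, a₃, a₄, a₆⟩) :
    W.baseChange ℚ_[p] = ⟨(a₁ : ℚ_[p]), (a₂ : ℚ_[p]), (a₃ : ℚ_[p]), (a₄ : ℚ_[p]), (a₆ : ℚ_[p])⟩ := by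
  subst hW
  ext <;> simp [WeierstrassCurve.baseChange, WeierstrassCurve.map]

/-- `g` of the base-changed curve at a `p`-adic integer is the integer polynomial `gList`. -/
private theorem g_eq_aeval (W : WeierstrassCurve ℚ) (hW : W = ⟨a₁, a₂, a₃, a₄, a₆⟩) (z : ℤ_[p]) :
    4 * (z : ℚ_[p]) ^ 3 + (W.baseChange ℚ_[p]).b₂ * (z : ℚ_[p]) ^ 2 +
        2 * (W.baseChange ℚ_[p]).b₄ * (z : ℚ_[p]) + (W.baseChange ℚ_[p]).b₆ =
      ((aeval z (ofList (gList a₁ a₂ a₃ a₄ a₆)) : ℤ_[p]) : ℚ_[p]) := by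
  rw [coe_aeval_ofList, baseChange_eq p a₁ a₂ a₃ a₄ a₆ W hW]
  simp only [gList, bInvs, aeval_ofList_cons, aeval_ofList_nil,
    WeierstrassCurve.b₂, WeierstrassCurve.b₄, WeierstrassCurve.b₆]
  push_cast
  ring

/-- A rational affine point stays nonsingular in `E(ℚ_p)` (Mathlib `baseChange_nonsingular`).
[folklore] -/
theorem nonsingular_ofId (W : WeierstrassCurve ℚ) {x y : ℚ} (h : W.toAffine.Nonsingular x y) :
    (W.baseChange ℚ_[p]).toAffine.Nonsingular (Algebra.ofId ℚ ℚ_[p] x) (Algebra.ofId ℚ ℚ_[p] y) :=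
  (Affine.baseChange_nonsingular (W := W) (f := Algebra.ofId ℚ ℚ_[p])
    (Algebra.ofId ℚ ℚ_[p]).injective x y).mpr h

/-- A rational affine point read in `E(ℚ_p)`: the base change of `(x, y)` is the affine point
`(x, y)` of `E ⊗ ℚ_p` (Mathlib `Affine.Point.map_some`). [folklore] -/
theorem baseChange_some (W : WeierstrassCurve ℚ) {x y : ℚ} (h : W.toAffine.Nonsingular x y) :
    WeierstrassCurve.Affine.Point.baseChange (W' := W) ℚ ℚ_[p] (.some x y h) =
      .some (Algebra.ofId ℚ ℚ_[p] x) (Algebra.ofId ℚ ℚ_[p] y) (nonsingular_ofId p W h) := by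
  change WeierstrassCurve.Affine.Point.map (W' := W) (Algebra.ofId ℚ ℚ_[p]) (.some x y h) = _
  rw [WeierstrassCurve.Affine.Point.map_some]

/-- `x = num / den` read in `ℚ_p`. [folklore] -/
theorem ofId_eq_div {x : ℚ} {num den : ℤ} (hx : x = num / den) :
    Algebra.ofId ℚ ℚ_[p] x = (num : ℚ_[p]) / (den : ℚ_[p]) := by
  rw [Algebra.ofId_apply, hx, map_div₀, map_intCast, map_intCast]

/-- **YES soundness (general `n`).** If the integer list `l` computes the `n`-division equation
`den·Φₙ − num·ΨSqₙ` of `E ⊗ ℚ_p` (`x(P) = num/den`, `den ≠ 0`) and `divCertOKAt p l g (c,m,N,w)`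
holds, then `P|_{ℚ_p} ∈ n·E(ℚ_p)`. [folklore] -/
theorem exists_nsmul_eq_padic_of_divCertOKAt (W : WeierstrassCurve ℚ) [W.IsElliptic]
    (hW : W = ⟨a₁, a₂, a₃, a₄, a₆⟩) (n : ℕ) (l : List ℤ) (num den : ℤ) (hden : den ≠ 0)
    (hl : ∀ z : ℚ_[p], aeval z (ofList l) =
      (den : ℚ_[p]) * ((W.baseChange ℚ_[p]).Φ n).eval z -
        (num : ℚ_[p]) * ((W.baseChange ℚ_[p]).ΨSq n).eval z)
    {x y : ℚ} (h : W.toAffine.Nonsingular x y) (hx : x = num / den)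
    {e : ℤ × ℕ × ℕ × ℕ} (he : divCertOKAt p l (gList a₁ a₂ a₃ a₄ a₆) e = true) :
    ∃ Q : (W.baseChange ℚ_[p]).toAffine.Point,
      n • Q = WeierstrassCurve.Affine.Point.baseChange (W' := W) ℚ ℚ_[p] (.some x y h) := by
  -- unpack the certificate
  simp only [divCertOKAt, Bool.and_eq_true] at he
  obtain ⟨⟨hhen, hg⟩, hflag⟩ := he
  obtain ⟨hN, hdm, hndm, hdN⟩ := henselOKAt_spec hhen
  obtain ⟨hw, hw', hprecN⟩ := gEntryOKAt_spec hg
  -- real-number facts about `p`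
  have hp1 : (1 : ℝ) < p := by exact_mod_cast hp.out.one_lt
  have hpR : (p : ℝ) ≠ 0 := by positivity
  -- the curve over `ℚ_p`
  set E := W.baseChange ℚ_[p] with hEdef
  have h2 : (2 : ℚ_[p]) ≠ 0 := two_ne_zero
  -- the Hensel root `z`
  obtain ⟨z, hz0, hzc⟩ := exists_root_of_hensel_data (p := p) l hN hdm hndm hdN
  -- `g(z)` is a non-zero square (read at `c`, FILE L1)
  set lg := gList a₁ a₂ a₃ a₄ a₆ with hlg
  set gc : ℤ := evalList lg e.1 with hgc
  have hgc0 : (gc : ℚ_[p]) ≠ 0 := by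
    have : gc ≠ 0 := by rintro h0; rw [h0] at hw'; exact hw' (dvd_zero _)
    exact_mod_cast this
  have hgcn : ‖(gc : ℚ_[p])‖ = (p : ℝ) ^ (-(e.2.2.2 : ℤ)) := norm_intCast_padic_eq hw hw'
  have hG := g_eq_aeval p a₁ a₂ a₃ a₄ a₆ W hW z
  rw [← hEdef] at hG
  have hdist : ‖((aeval z (ofList lg) : ℤ_[p]) : ℚ_[p]) - (gc : ℚ_[p])‖ ≤
      (p : ℝ) ^ (-(sqPrecAt p : ℤ)) * ‖(gc : ℚ_[p])‖ := by
    have h1 := padic_polynomial_dist (ofList lg) z (e.1 : ℤ_[p])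
    rw [aeval_intCast_ofList] at h1
    rw [hgcn, ← PadicInt.coe_intCast, ← PadicInt.coe_sub, ← PadicInt.norm_def]
    refine (h1.trans hzc).trans ?_
    rw [← zpow_add₀ hpR]
    have hmN : e.2.1 ≤ e.2.2.1 := by omega
    exact zpow_le_zpow_right₀ hp1.le (by push_cast [Nat.cast_sub hmN]; omega)
  obtain ⟨hG0, hGsq⟩ := isSquare_iff_of_norm_sub_le (one_le_sqPrecAt p)
    (fun h => sqPrecAt_eq_three_of_eq_two h) hgc0 hdist
  have hsq : IsSquare ((aeval z (ofList lg) : ℤ_[p]) : ℚ_[p]) :=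
    hGsq.mpr ((isSquare_intCast_padic_iff_sqFlagAt (p := p) gc e.2.2.2 hw hw').mpr hflag)
  rw [← hG] at hsq hG0
  -- a point `(z, y_z)` on `E`
  obtain ⟨r, hr⟩ := hsq
  set yz : ℚ_[p] := (r - E.a₁ * (z : ℚ_[p]) - E.a₃) / 2 with hyz
  have heq : E.toAffine.Equation (z : ℚ_[p]) yz := by
    rw [equation_iff_sq_eq_g E h2, hr]
    have : 2 * yz + E.a₁ * (z : ℚ_[p]) + E.a₃ = r := by
      rw [hyz]; field_simp; ring
    rw [this]; ring
  have hns : E.toAffine.Nonsingular (z : ℚ_[p]) yz := (Affine.equation_iff_nonsingular ..).mp heq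
  -- `F_P(z) = 0`
  have hF : (den : ℚ_[p]) * (E.Φ n).eval (z : ℚ_[p]) - (num : ℚ_[p]) * (E.ΨSq n).eval (z : ℚ_[p]) =
      0 := by
    rw [hEdef, ← hl, ← coe_aeval_ofList, hz0, PadicInt.coe_zero]
  -- the point `P` over `ℚ_p`
  obtain ⟨Q, hQ⟩ := exists_nsmul_eq_of_eval_divEq_eq_zero E hns (nonsingular_ofId p W h) n
    (by exact_mod_cast hden) (ofId_eq_div p hx) hF
  exact ⟨Q, by rw [hQ, baseChange_some]⟩

/-- **NO soundness (general `n`).** If `l` computes the `n`-division equation of `P|_{ℚ_p}` and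
`nonDivCheckAt p l k` holds (unit leading coefficient, empty root census), then
`P|_{ℚ_p} ∉ n·E(ℚ_p)`. [folklore] -/
theorem not_exists_nsmul_eq_padic_of_nonDivCheckAt (W : WeierstrassCurve ℚ) [W.IsElliptic]
    (n : ℕ) (l : List ℤ) (num den : ℤ) (hden : den ≠ 0)
    (hl : ∀ z : ℚ_[p], aeval z (ofList l) =
      (den : ℚ_[p]) * ((W.baseChange ℚ_[p]).Φ n).eval z -
        (num : ℚ_[p]) * ((W.baseChange ℚ_[p]).ΨSq n).eval z)
    {x y : ℚ} (h : W.toAffine.Nonsingular x y) (hx : x = num / den)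
    {k : ℕ} (hc : nonDivCheckAt p l k = true) :
    ¬ ∃ Q : (W.baseChange ℚ_[p]).toAffine.Point,
      n • Q = WeierstrassCurve.Affine.Point.baseChange (W' := W) ℚ ℚ_[p] (.some x y h) := by
  rw [baseChange_some]
  rintro ⟨_ | ⟨z, yz, hz⟩, hQ⟩
  · rw [← Affine.Point.zero_def, nsmul_zero] at hQ
    exact Affine.Point.some_ne_zero _ hQ.symm
  · simp only [nonDivCheckAt, Bool.and_eq_true] at hc
    obtain ⟨hlast, hcheck⟩ := hc
    obtain ⟨c, hlc, hcp⟩ := exists_of_lastUnitAt hlast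
    have hF := eval_divEq_eq_zero_of_nsmul_eq _ hz (nonsingular_ofId p W h) n
      (by exact_mod_cast hden) (ofId_eq_div p hx) hQ
    have hroot : aeval z (ofList l) = 0 := by rw [hl]; exact hF
    have hz1 : ‖z‖ ≤ 1 := norm_le_one_of_aeval_eq_zero (p := p) l hlc hcp hroot
    obtain ⟨ρ, -, -, hcomplete⟩ := exists_roots_of_check₂ (p := p) l k [] hcheck
    obtain ⟨i, -⟩ := hcomplete ⟨z, hz1⟩ (by
      apply PadicInt.coe_eq_zero.mp
      rw [coe_aeval_ofList]
      exact hroot)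
    exact i.elim0

/-- **GLOBAL COROLLARY (general `n`): `P ∉ n·E(ℚ)`** — in the exact currency
`P ∉ (zsmulAddGroupHom (n : ℤ)).range` of the binder `hP` of
`VisibleWitness.exists_sha_ne_zero_of_congr_of_locallyDivisible` — from ONE prime `p` at which the
NO check holds (a global `n`-th root would be a local one). [folklore] -/
theorem not_mem_range_zsmul_of_nonDivCheckAt (W : WeierstrassCurve ℚ) [W.IsElliptic]
    (n : ℕ) (l : List ℤ) (num den : ℤ) (hden : den ≠ 0)
    (hl : ∀ z : ℚ_[p], aeval z (ofList l) =
      (den : ℚ_[p]) * ((W.baseChange ℚ_[p]).Φ n).eval z -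
        (num : ℚ_[p]) * ((W.baseChange ℚ_[p]).ΨSq n).eval z)
    {x y : ℚ} (h : W.toAffine.Nonsingular x y) (hx : x = num / den)
    {k : ℕ} (hc : nonDivCheckAt p l k = true) :
    (Affine.Point.some x y h : W.toAffine.Point) ∉
      (zsmulAddGroupHom (n : ℤ) : W.toAffine.Point →+ W.toAffine.Point).range := by
  rintro ⟨R, hR⟩
  apply not_exists_nsmul_eq_padic_of_nonDivCheckAt p W n l num den hden hl h hx hc
  refine ⟨WeierstrassCurve.Affine.Point.baseChange (W' := W) ℚ ℚ_[p] R, ?_⟩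
  rw [← map_nsmul, ← natCast_zsmul]
  exact congrArg _ hR

end Main

/-! ### §2 The `3`-division decider

The abstract division-equation binder `hl` of §1 is DISCHARGED here for `n = 3` by FILE D1's
`aeval_threeDivList` (`hl_three`), and `hx` by `Rat.num_div_den`: the ENDs below display only
`hW`, the point's nonsingularity `h` (decidable on literals) and the certificate check `he` / `hc`. -/

section Three

variable (p : ℕ) [hp : Fact p.Prime] (a₁ a₂ a₃ a₄ a₆ : ℤ)

/-- `threeDivList` computes the `3`-division equation of `E ⊗ ℚ_p`. -/
private theorem hl_three (W : WeierstrassCurve ℚ) (hW : W = ⟨a₁, a₂, a₃, a₄, a₆⟩) (num den : ℤ)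
    (z : ℚ_[p]) : aeval z (ofList (threeDivList a₁ a₂ a₃ a₄ a₆ num den)) =
      (den : ℚ_[p]) * ((W.baseChange ℚ_[p]).Φ 3).eval z -
        (num : ℚ_[p]) * ((W.baseChange ℚ_[p]).ΨSq 3).eval z := by
  rw [baseChange_eq p a₁ a₂ a₃ a₄ a₆ W hW, aeval_threeDivList]

/-- `x = num(x) / den(x)` with the denominator cast through `ℤ`. -/
private theorem rat_eq_num_div_den (x : ℚ) : x = (x.num : ℚ) / ((x.den : ℤ) : ℚ) := by
  rw [Int.cast_natCast]; exact (Rat.num_div_den x).symm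

/-- **THE YES DECIDER for `3`-division at `p`.** If `threeDivCertAt p a₁ … a₆ (num x) (den x) e`
holds for the rational point `P = (x, y)` of the integer model `W = ⟨a₁, …, a₆⟩`, then
`P|_{ℚ_p} = 3 • Q` for some `Q ∈ E(ℚ_p)` — the first disjunct of `hdiv` in
`VisibleWitness.exists_sha_ne_zero_of_congr_of_locallyDivisible`, over `ℚ_[p]`. [folklore] -/
theorem exists_three_nsmul_eq_padic_of_cert (W : WeierstrassCurve ℚ) [W.IsElliptic]
    (hW : W = ⟨a₁, a₂, a₃, a₄, a₆⟩) {x y : ℚ} (h : W.toAffine.Nonsingular x y)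
    {e : ℤ × ℕ × ℕ × ℕ} (he : threeDivCertAt p a₁ a₂ a₃ a₄ a₆ x.num x.den e = true) :
    ∃ Q : (W.baseChange ℚ_[p]).toAffine.Point,
      (3 : ℕ) • Q = WeierstrassCurve.Affine.Point.baseChange (W' := W) ℚ ℚ_[p] (.some x y h) :=
  exists_nsmul_eq_padic_of_divCertOKAt p a₁ a₂ a₃ a₄ a₆ W hW 3 _ x.num (x.den : ℤ)
    (by exact_mod_cast x.den_nz) (hl_three p a₁ a₂ a₃ a₄ a₆ W hW x.num x.den) h
    (rat_eq_num_div_den x) he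

/-- **THE NO DECIDER for `3`-division at `p`.** If `threeNonDivCheckAt p a₁ … a₆ (num x) (den x) k`
holds (so `p ∤ den x`: `P ∉ E₁(ℚ_p)`; and the root census of the `3`-division equation in `ℤ_p` is
empty), then `P|_{ℚ_p} ∉ 3·E(ℚ_p)`. [folklore] -/
theorem not_exists_three_nsmul_eq_padic_of_check (W : WeierstrassCurve ℚ) [W.IsElliptic]
    (hW : W = ⟨a₁, a₂, a₃, a₄, a₆⟩) {x y : ℚ} (h : W.toAffine.Nonsingular x y) {k : ℕ}
    (hc : threeNonDivCheckAt p a₁ a₂ a₃ a₄ a₆ x.num x.den k = true) :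
    ¬ ∃ Q : (W.baseChange ℚ_[p]).toAffine.Point,
      (3 : ℕ) • Q = WeierstrassCurve.Affine.Point.baseChange (W' := W) ℚ ℚ_[p] (.some x y h) :=
  not_exists_nsmul_eq_padic_of_nonDivCheckAt p W 3 _ x.num (x.den : ℤ) (by exact_mod_cast x.den_nz)
    (hl_three p a₁ a₂ a₃ a₄ a₆ W hW x.num x.den) h (rat_eq_num_div_den x) hc

/-- **THE GLOBAL COROLLARY: `P ∉ 3·E(ℚ)`** (the binder `hP` of the witness theorem
`VisibleWitness.exists_sha_ne_zero_of_congr_of_locallyDivisible` at `p = 3`, in its exact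
currency) from ONE auxiliary prime `p` at which `threeNonDivCheckAt` holds. [folklore] -/
theorem not_mem_range_zsmul_three_of_check (W : WeierstrassCurve ℚ) [W.IsElliptic]
    (hW : W = ⟨a₁, a₂, a₃, a₄, a₆⟩) {x y : ℚ} (h : W.toAffine.Nonsingular x y) {k : ℕ}
    (hc : threeNonDivCheckAt p a₁ a₂ a₃ a₄ a₆ x.num x.den k = true) :
    (Affine.Point.some x y h : W.toAffine.Point) ∉
      (zsmulAddGroupHom ((3 : ℕ) : ℤ) : W.toAffine.Point →+ W.toAffine.Point).range :=
  not_mem_range_zsmul_of_nonDivCheckAt p W 3 _ x.num (x.den : ℤ) (by exact_mod_cast x.den_nz)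
    (hl_three p a₁ a₂ a₃ a₄ a₆ W hW x.num x.den) h (rat_eq_num_div_den x) hc

end Three

/-! ### §3 Two instances by `decide +kernel` (self-test of the numeral road; ellipticity and the
point's nonsingularity displayed as binders — the records seats discharge them) -/

section Instances

/-- **Instance `394227f1`** (`[1, -1, 0, -321, 2294]`, rank 2; partner of the N11 row `306621e1`
in r1's T-VIS3 census, ROUTE-1 §41.7; one of the five pairs OUTSIDE every formal-group road,
n1011-p09 GEN 10, cells INBOX 2026-08-21T22:16Z): the generator `P₂ = (82/9, 92/27)` itself (a
point of `E'₁(ℚ₃)` of depth `1`) is `3`-DIVISIBLE in `E'(ℚ₃)`: the `3`-division equation of `P₂`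
has the Hensel ball `c = 116`, `m = 2`, `N = 5` in `ℤ₃` with `g(c)` a `3`-adic unit square
(`w = 0`) — a cube root `Q ∉ E'₁(ℚ₃)`. [folklore] -/
theorem exists_three_nsmul_eq_padic_394227f1 (W' : WeierstrassCurve ℚ) [W'.IsElliptic]
    (hW' : W' = ⟨1, -1, 0, -321, 2294⟩) (h : W'.toAffine.Nonsingular (82 / 9) (92 / 27)) :
    ∃ Q : (W'.baseChange ℚ_[3]).toAffine.Point,
      (3 : ℕ) • Q = WeierstrassCurve.Affine.Point.baseChange (W' := W') ℚ ℚ_[3]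
        (.some (82 / 9) (92 / 27) h) :=
  exists_three_nsmul_eq_padic_of_cert 3 1 (-1) 0 (-321) 2294 W' hW' h (e := (116, 2, 5, 0))
    (by decide +kernel)

/-- **Instance `18774l1`** (`[1, -1, 0, 12690, 862164]`, rank 2; partner of the N11 row `18774o1`):
the generator `P₁ = (117, 1926)` is NOT `3`-divisible in `E'(ℚ₂)` — the `3`-division equation of
`P₁` has no root in `ℤ₂` (empty census at precision `4`) and leading coefficient `1` — hence
**`P₁ ∉ 3·E'(ℚ)`**: the binder `hP` of the witness theorem for this pair, with no appeal to the
saturation of the Mordell–Weil basis. [folklore] -/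
theorem not_mem_range_zsmul_three_18774l1 (W' : WeierstrassCurve ℚ) [W'.IsElliptic]
    (hW' : W' = ⟨1, -1, 0, 12690, 862164⟩) (h : W'.toAffine.Nonsingular 117 1926) :
    (Affine.Point.some 117 1926 h : W'.toAffine.Point) ∉
      (zsmulAddGroupHom ((3 : ℕ) : ℤ) : W'.toAffine.Point →+ W'.toAffine.Point).range :=
  not_mem_range_zsmul_three_of_check 2 1 (-1) 0 12690 862164 W' hW' h (k := 4) (by decide +kernel)

end Instances



end Summit.BirchSwinnertonDyer.Rank1Residual.GaloisImage.DivisionDecider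

end
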